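import Literature.NumberTheory.LFunctions.SelbergClassEulerLogCoefficients
import Mathlib.NumberTheory.SumPrimeReciprocals
import Mathlib.Analysis.SpecialFunctions.Pow.Real
import HarnessLib

/-!
# Strong multiplicity one for the Selberg class: prime-power sums for the difference `c = b_F − b_G`

Layer 3 of the formalisation of K. Soundararajan, *Strong multiplicity one for the Selberg class*,
Canad. Math. Bull. 47 (2004) 468–474 = arXiv:math/0210299 (named fact
`Literature.NumberTheory.LFunctions.Soundararajan2004_strongMultiplicityOne_thinSet`). Pure proof
file (theorems only), namespace `Literature.NumberTheory.LFunctions.Soundararajan2004`.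

Setting (p. 1 of the source): `F, G ∈ 𝒮` (two `SelbergDatum`s `D₁, D₂` with Euler exponent
coefficients `b₁, b₂`, exponents `θ₁, θ₂ < 1/2`, cf. `SelbergClassEulerLogCoefficients.lean`),
`a_F(p) = a_G(p)` for the primes `p ∉ 𝓔`, where `#{p ∈ 𝓔 : p ≤ x} ≤ C x^{1/2−δ}` (hypothesis (2)),
and `c(n) = b_F(n) − b_G(n)`. This file proves the convergence statements behind the sentence
"Thus the RHS of (4) is an entire function in `re s > 1/2`" (p. 1) and the two `O(1)` estimates of
p. 2 ("`∑_p |c(p) g(log p/L)| log p/√p = O(1)`", "`∑_{k ≥ 3} ∑_p |c(p^k) log p g(k log p/L)|/p^{k/2} = O(1)`"):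

* `summable_indicator_rpow_neg_of_ncard_le`, `…_mul_log_…`, `summable_thin_primes_rpow_neg_mul_log`
  — dyadic counting: a set with `#{n ≤ x} ≤ C x^β` has `∑ n^{-α} log n < ∞` for `α > β`.
* `diff_prime_eq_zero` — `c(p) = 0` for `p ∉ 𝓔` (`b(p) = a(p)`).
* `summable_norm_diff_prime` — `∑_p |c(p)| log p/√p < ∞` (thin set, `c(p) ≪ p^ε`, `ε < δ`).
* `summable_norm_diff_prime_sq` — `∑_p |c(p²)| log(p²) p^{-2σ} < ∞` for `σ > 1/2`.
* `summable_norm_diff_prime_pow_three` — `∑_p ∑_{k ≥ 3} |c(p^k)| log(p^k) p^{-k/2} < ∞`. (As printed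
  the tail `k ≥ 4` is bounded by `c(n) ≪ n^ϑ`, which needs `ϑ < 1/4`; in general one splits at `K`
  with `K(1/2 − ϑ) > 1` and uses `c(p^k) ≪_k p^{kε}` below `K` — a harmless repair.)
* `summable_norm_diff_mul_log_mul_rpow`, `LSeriesSummable_logMul_diff` — hence
  `∑ |c(n)| log n · n^{-σ} < ∞` for every `σ > 1/2`, i.e. `∑ c(n) log n n^{-s}` converges
  absolutely on `re s > 1/2`.

All hypotheses on `(b₁, θ₁)`, `(b₂, θ₂)` are the three properties packaged in the field
`SelbergDatum.euler_product`; the thin-set hypothesis is written exactly as in the named fact.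

## References

* K. Soundararajan, *Strong multiplicity one for the Selberg class*, Canad. Math. Bull. 47 (2004)
  468–474; arXiv:math/0210299, pp. 1–2. [Soundararajan2002]
-/

noncomputable section

open Complex Filter Topology Set Asymptotics Finset

namespace Literature.NumberTheory.LFunctions

namespace Soundararajan2004

/-- **Dyadic counting ⇒ convergence.** If `E ⊆ {n ≥ 2}` has counting function
`#{n ∈ E : n ≤ x} ≤ C x^β` for `x ≥ 2` (`β ≥ 0`), then `∑_{n ∈ E} n^{-α} < ∞` for every `α > β`
(the block `2^j ≤ n < 2^{j+1}` contributes `≤ C 2^β (2^{β-α})^j`). This is the use made of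
hypothesis (2) of Soundararajan's theorem ("`∑_p c(p) log p/p^s` is entire in `re s > 1/2 − δ`",
p. 1). [cite: Soundararajan2002, p. 1] -/
theorem summable_indicator_rpow_neg_of_ncard_le {E : Set ℕ} {β C α : ℝ}
    (hE2 : ∀ n ∈ E, 2 ≤ n)
    (hcount : ∀ x : ℝ, 2 ≤ x → (Set.ncard {n : ℕ | n ∈ E ∧ (n : ℝ) ≤ x} : ℝ) ≤ C * x ^ β)
    (hβ : 0 ≤ β) (hα : β < α) :
    Summable (E.indicator fun n : ℕ ↦ (n : ℝ) ^ (-α)) := by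
  classical
  set f : ℕ → ℝ := E.indicator fun n : ℕ ↦ (n : ℝ) ^ (-α) with hf
  have hf0 : ∀ n, 0 ≤ f n := fun n ↦
    Set.indicator_nonneg (fun m _ ↦ Real.rpow_nonneg (Nat.cast_nonneg m) _) n
  set C' : ℝ := max C 0 with hC'
  have hC'0 : 0 ≤ C' := le_max_right _ _
  have hcount' : ∀ x : ℝ, 2 ≤ x → (Set.ncard {n : ℕ | n ∈ E ∧ (n : ℝ) ≤ x} : ℝ) ≤ C' * x ^ β :=
    fun x hx ↦ (hcount x hx).trans (mul_le_mul_of_nonneg_right (le_max_left _ _)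
      (Real.rpow_nonneg (by linarith) _))
  set r : ℝ := (2 : ℝ) ^ (β - α) with hr
  have hr0 : 0 ≤ r := Real.rpow_nonneg zero_le_two _
  have hr1 : r < 1 := Real.rpow_lt_one_of_one_lt_of_neg one_lt_two (by linarith)
  -- the block estimate
  have hblock : ∀ j : ℕ, ∑ i ∈ Finset.Ico (2 ^ j) (2 ^ (j + 1)), f i ≤ C' * 2 ^ β * r ^ j := by
    intro j
    have h2j : (0 : ℝ) < (2 : ℝ) ^ j := by positivity
    -- each term is at most the indicator of `E` times `(2^j)^{-α}`
    have hle : ∀ i ∈ Finset.Ico (2 ^ j) (2 ^ (j + 1)),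
        f i ≤ if i ∈ E then ((2 : ℝ) ^ j) ^ (-α) else 0 := by
      intro i hi
      simp only [hf, Set.indicator_apply]
      split_ifs with hiE
      · have hi1 : ((2 : ℝ) ^ j) ≤ (i : ℝ) := by exact_mod_cast (Finset.mem_Ico.mp hi).1
        exact Real.rpow_le_rpow_of_nonpos h2j hi1 (by linarith)
      · exact le_rfl
    refine (Finset.sum_le_sum hle).trans ?_
    rw [← Finset.sum_filter, Finset.sum_const, nsmul_eq_mul]
    -- the number of elements of `E` in the block
    have hcard : (((Finset.Ico (2 ^ j) (2 ^ (j + 1))).filter (· ∈ E)).card : ℝ) ≤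
        C' * ((2 : ℝ) ^ (j + 1)) ^ β := by
      have hfin : ({n : ℕ | n ∈ E ∧ (n : ℝ) ≤ (2 : ℝ) ^ (j + 1)}).Finite := by
        refine (Set.finite_Iic (2 ^ (j + 1))).subset fun n hn ↦ ?_
        exact_mod_cast hn.2
      have hsub : (((Finset.Ico (2 ^ j) (2 ^ (j + 1))).filter (· ∈ E) : Finset ℕ) : Set ℕ) ⊆
          {n : ℕ | n ∈ E ∧ (n : ℝ) ≤ (2 : ℝ) ^ (j + 1)} := by
        intro n hn
        simp only [Finset.coe_filter, Finset.mem_Ico, Set.mem_setOf_eq] at hn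
        exact ⟨hn.2, by exact_mod_cast hn.1.2.le⟩
      have h1 := Set.ncard_le_ncard hsub hfin
      rw [Set.ncard_coe_finset] at h1
      have h2 := hcount' ((2 : ℝ) ^ (j + 1)) (by
        calc (2 : ℝ) = 2 ^ 1 := by norm_num
          _ ≤ 2 ^ (j + 1) := pow_le_pow_right₀ one_le_two (by omega))
      exact (Nat.cast_le.mpr h1).trans h2
    calc (((Finset.Ico (2 ^ j) (2 ^ (j + 1))).filter (· ∈ E)).card : ℝ) * ((2 : ℝ) ^ j) ^ (-α)
        ≤ C' * ((2 : ℝ) ^ (j + 1)) ^ β * ((2 : ℝ) ^ j) ^ (-α) :=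
          mul_le_mul_of_nonneg_right hcard (Real.rpow_nonneg h2j.le _)
      _ = C' * 2 ^ β * r ^ j := by
          rw [hr, ← Real.rpow_natCast (2 : ℝ) j, ← Real.rpow_natCast (2 : ℝ) (j + 1),
            ← Real.rpow_mul zero_le_two, ← Real.rpow_mul zero_le_two,
            ← Real.rpow_natCast ((2 : ℝ) ^ (β - α)) j, ← Real.rpow_mul zero_le_two]
          rw [mul_assoc, mul_assoc, ← Real.rpow_add two_pos, ← Real.rpow_add two_pos]
          congr 2
          push_cast
          ring
  -- partial sums over `[0, 2^J)` are bounded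
  have hf01 : f 0 = 0 ∧ f 1 = 0 := by
    constructor
    · have : (0 : ℕ) ∉ E := fun h ↦ by have := hE2 0 h; omega
      simp [hf, this]
    · have : (1 : ℕ) ∉ E := fun h ↦ by have := hE2 1 h; omega
      simp [hf, this]
  set M : ℝ := C' * 2 ^ β * (1 - r)⁻¹ with hM
  have hgeom : ∀ J : ℕ, ∑ j ∈ Finset.range J, r ^ j ≤ (1 - r)⁻¹ := fun J ↦
    ((summable_geometric_of_lt_one hr0 hr1).sum_le_tsum _ (fun _ _ ↦ pow_nonneg hr0 _)).trans_eq
      (tsum_geometric_of_lt_one hr0 hr1)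
  have hall : ∀ K : ℕ, ∑ i ∈ Finset.range (2 ^ K), f i ≤
      C' * 2 ^ β * ∑ j ∈ Finset.range K, r ^ j := by
    intro K
    induction K with
    | zero => simp [hf01.1]
    | succ K ihK =>
      rw [Finset.range_eq_Ico] at ihK ⊢
      rw [← Finset.sum_Ico_consecutive f (Nat.zero_le _)
        (pow_le_pow_right₀ one_le_two (Nat.le_succ K)), Finset.sum_range_succ, mul_add]
      exact add_le_add ihK (hblock K)
  have hdyadic : ∀ J : ℕ, ∑ i ∈ Finset.range (2 ^ J), f i ≤ M := fun J ↦
    (hall J).trans (mul_le_mul_of_nonneg_left (hgeom _) (by positivity))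
  refine summable_of_sum_range_le hf0 (c := M) fun n ↦ ?_
  calc ∑ i ∈ Finset.range n, f i ≤ ∑ i ∈ Finset.range (2 ^ n), f i :=
        Finset.sum_le_sum_of_subset_of_nonneg
          (Finset.range_mono (Nat.lt_two_pow_self).le) fun i _ _ ↦ hf0 i
    _ ≤ M := hdyadic n

end Soundararajan2004
end Literature.NumberTheory.LFunctions


namespace Literature.NumberTheory.LFunctions
namespace Soundararajan2004

/-- The same with a logarithm: `∑_{n ∈ E} n^{-α} log n < ∞` for `α > β` (absorb `log n ≤ n^η/η`).
[cite: Soundararajan2002, p. 1] -/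
theorem summable_indicator_rpow_neg_mul_log_of_ncard_le {E : Set ℕ} {β C α : ℝ}
    (hE2 : ∀ n ∈ E, 2 ≤ n)
    (hcount : ∀ x : ℝ, 2 ≤ x → (Set.ncard {n : ℕ | n ∈ E ∧ (n : ℝ) ≤ x} : ℝ) ≤ C * x ^ β)
    (hβ : 0 ≤ β) (hα : β < α) :
    Summable (E.indicator fun n : ℕ ↦ (n : ℝ) ^ (-α) * Real.log n) := by
  set η : ℝ := (α - β) / 2 with hη
  have hη0 : 0 < η := by rw [hη]; linarith
  have hsum := summable_indicator_rpow_neg_of_ncard_le hE2 hcount hβ (α := α - η) (by linarith)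
  refine (hsum.mul_left η⁻¹).of_nonneg_of_le (fun n ↦ ?_) (fun n ↦ ?_)
  · refine Set.indicator_nonneg (fun m hm ↦ ?_) n
    exact mul_nonneg (Real.rpow_nonneg (Nat.cast_nonneg m) _)
      (Real.log_nonneg (by exact_mod_cast (Nat.one_le_iff_ne_zero.mpr (by have := hE2 m hm; omega))))
  · by_cases hn : n ∈ E
    · rw [Set.indicator_of_mem hn, Set.indicator_of_mem hn]
      have hn0 : (0 : ℝ) < n := by exact_mod_cast (show 0 < n by have := hE2 n hn; omega)
      have hlog : Real.log n ≤ (n : ℝ) ^ η / η := Real.log_le_rpow_div hn0.le hη0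
      calc (n : ℝ) ^ (-α) * Real.log n ≤ (n : ℝ) ^ (-α) * ((n : ℝ) ^ η / η) :=
            mul_le_mul_of_nonneg_left hlog (Real.rpow_nonneg hn0.le _)
        _ = η⁻¹ * (n : ℝ) ^ (-(α - η)) := by
            rw [div_eq_mul_inv, ← mul_assoc, ← Real.rpow_add hn0]
            ring_nf
    · rw [Set.indicator_of_notMem hn, Set.indicator_of_notMem hn, mul_zero]

/-- **The thin exceptional set of primes.** Under hypothesis (2) of Soundararajan's theorem,
`#{p ∈ 𝓔 prime : p ≤ x} ≤ C x^{1/2 − δ}` (`x ≥ 2`), the sums `∑_{p ∈ 𝓔 prime} p^{-α} log p`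
converge for every `α > max(1/2 − δ, 0)`. [cite: Soundararajan2002, (2)] -/
theorem summable_thin_primes_rpow_neg_mul_log {𝓔 : Set ℕ} {δ C α : ℝ}
    (hthin : ∀ x : ℝ, 2 ≤ x →
      (Set.ncard {p : ℕ | p ∈ 𝓔 ∧ p.Prime ∧ (p : ℝ) ≤ x} : ℝ) ≤ C * x ^ (1 / 2 - δ))
    (hα : max (1 / 2 - δ) 0 < α) :
    Summable ({p : ℕ | p ∈ 𝓔 ∧ p.Prime}.indicator fun n : ℕ ↦ (n : ℝ) ^ (-α) * Real.log n) := by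
  refine summable_indicator_rpow_neg_mul_log_of_ncard_le (β := max (1 / 2 - δ) 0) (C := max C 0)
    (fun n hn ↦ hn.2.two_le) (fun x hx ↦ ?_) (le_max_right _ _) hα
  have hx1 : (1 : ℝ) ≤ x := by linarith
  have hset : {n : ℕ | n ∈ {p : ℕ | p ∈ 𝓔 ∧ p.Prime} ∧ (n : ℝ) ≤ x} =
      {p : ℕ | p ∈ 𝓔 ∧ p.Prime ∧ (p : ℝ) ≤ x} := by
    ext n; simp [and_assoc]
  rw [hset]
  calc (Set.ncard {p : ℕ | p ∈ 𝓔 ∧ p.Prime ∧ (p : ℝ) ≤ x} : ℝ) ≤ C * x ^ (1 / 2 - δ) := hthin x hx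
    _ ≤ max C 0 * x ^ (1 / 2 - δ) :=
        mul_le_mul_of_nonneg_right (le_max_left _ _) (Real.rpow_nonneg (by linarith) _)
    _ ≤ max C 0 * x ^ (max (1 / 2 - δ) 0) :=
        mul_le_mul_of_nonneg_left (Real.rpow_le_rpow_of_exponent_le hx1 (le_max_left _ _))
          (le_max_right _ _)


/-! ### The coefficients `c(n) = b_F(n) - b_G(n)` on primes and prime squares -/

section Pair

variable {D₁ D₂ : SelbergDatum} {b₁ b₂ : ℕ → ℂ} {θ₁ θ₂ : ℝ}

/-- `c(p) = b_F(p) - b_G(p) = a_F(p) - a_G(p)` vanishes at the primes outside the exceptional set.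
[cite: Soundararajan2002, p. 1] -/
theorem diff_prime_eq_zero
    (hb₁ : ∀ n, ¬ IsPrimePow n → b₁ n = 0) (hO₁ : b₁ =O[atTop] fun n ↦ (n : ℝ) ^ θ₁)
    (hexp₁ : ∀ s : ℂ, 1 < s.re → cexp (LSeries b₁ s) = D₁.toFun s)
    (hb₂ : ∀ n, ¬ IsPrimePow n → b₂ n = 0) (hO₂ : b₂ =O[atTop] fun n ↦ (n : ℝ) ^ θ₂)
    (hexp₂ : ∀ s : ℂ, 1 < s.re → cexp (LSeries b₂ s) = D₂.toFun s)
    {𝓔 : Set ℕ} (hagree : ∀ p : ℕ, p.Prime → p ∉ 𝓔 → D₁.coeff p = D₂.coeff p)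
    {p : ℕ} (hp : p.Prime) (hpE : p ∉ 𝓔) : b₁ p - b₂ p = 0 := by
  rw [D₁.euler_coeff_prime hb₁ hO₁ hexp₁ hp, D₂.euler_coeff_prime hb₂ hO₂ hexp₂ hp,
    hagree p hp hpE, sub_self]

/-- **The prime part of `∑ |c(n)| Λ(n) n^{-1/2}` converges** ("since `|c(p)| ≪ p^ε` we see from (2)
that `∑_p |c(p) g(log p/L)| log p/√p = O(1)`", p. 2): `∑_p |c(p)| log p / √p < ∞`, because `c(p)`
vanishes off the thin set `𝓔` and is `≪ p^ε` (`ε < δ`) on it. [cite: Soundararajan2002, p. 2] -/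
theorem summable_norm_diff_prime
    (hb₁ : ∀ n, ¬ IsPrimePow n → b₁ n = 0) (hO₁ : b₁ =O[atTop] fun n ↦ (n : ℝ) ^ θ₁)
    (hexp₁ : ∀ s : ℂ, 1 < s.re → cexp (LSeries b₁ s) = D₁.toFun s)
    (hb₂ : ∀ n, ¬ IsPrimePow n → b₂ n = 0) (hO₂ : b₂ =O[atTop] fun n ↦ (n : ℝ) ^ θ₂)
    (hexp₂ : ∀ s : ℂ, 1 < s.re → cexp (LSeries b₂ s) = D₂.toFun s)
    {𝓔 : Set ℕ} {δ₀ C : ℝ} (hδ : 0 < δ₀)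
    (hthin : ∀ x : ℝ, 2 ≤ x →
      (Set.ncard {p : ℕ | p ∈ 𝓔 ∧ p.Prime ∧ (p : ℝ) ≤ x} : ℝ) ≤ C * x ^ (1 / 2 - δ₀))
    (hagree : ∀ p : ℕ, p.Prime → p ∉ 𝓔 → D₁.coeff p = D₂.coeff p) :
    Summable ({p : ℕ | p.Prime}.indicator
      fun n : ℕ ↦ ‖b₁ n - b₂ n‖ * Real.log n * (n : ℝ) ^ (-(1 / 2 : ℝ))) := by
  set ε : ℝ := min δ₀ (1 / 4) / 2 with hε
  have hε0 : 0 < ε := by rw [hε]; positivity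
  have hεδ : ε < δ₀ := by
    rw [hε]; linarith [min_le_left δ₀ (1 / 4)]
  have hε4 : ε ≤ 1 / 8 := by
    rw [hε]; linarith [min_le_right δ₀ (1 / 4)]
  obtain ⟨C₁, hC₁, ha₁⟩ := D₁.exists_norm_coeff_le ε hε0
  obtain ⟨C₂, hC₂, ha₂⟩ := D₂.exists_norm_coeff_le ε hε0
  have hthin' := summable_thin_primes_rpow_neg_mul_log hthin (α := 1 / 2 - ε)
    (max_lt (by linarith) (by linarith))
  refine (hthin'.mul_left (C₁ + C₂)).of_nonneg_of_le (fun n ↦ ?_) (fun n ↦ ?_)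
  · refine Set.indicator_nonneg (fun m (hm : m.Prime) ↦ ?_) n
    exact mul_nonneg (mul_nonneg (norm_nonneg _) (Real.log_nonneg (by exact_mod_cast hm.one_lt.le)))
      (Real.rpow_nonneg (Nat.cast_nonneg m) _)
  · by_cases hn : n.Prime
    · rw [Set.indicator_of_mem (show n ∈ {p : ℕ | p.Prime} from hn)]
      by_cases hnE : n ∈ 𝓔
      · rw [Set.indicator_of_mem (show n ∈ {p : ℕ | p ∈ 𝓔 ∧ p.Prime} from ⟨hnE, hn⟩)]
        have hn0 : (0 : ℝ) < n := by exact_mod_cast hn.pos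
        have hc : ‖b₁ n - b₂ n‖ ≤ (C₁ + C₂) * (n : ℝ) ^ ε := by
          rw [D₁.euler_coeff_prime hb₁ hO₁ hexp₁ hn, D₂.euler_coeff_prime hb₂ hO₂ hexp₂ hn]
          calc ‖D₁.coeff n - D₂.coeff n‖ ≤ ‖D₁.coeff n‖ + ‖D₂.coeff n‖ := norm_sub_le _ _
            _ ≤ C₁ * (n : ℝ) ^ ε + C₂ * (n : ℝ) ^ ε := add_le_add (ha₁ n hn.one_lt.le) (ha₂ n hn.one_lt.le)
            _ = (C₁ + C₂) * (n : ℝ) ^ ε := by ring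
        have hlog : 0 ≤ Real.log n := Real.log_nonneg (by exact_mod_cast hn.one_lt.le)
        calc ‖b₁ n - b₂ n‖ * Real.log n * (n : ℝ) ^ (-(1 / 2 : ℝ))
            ≤ (C₁ + C₂) * (n : ℝ) ^ ε * Real.log n * (n : ℝ) ^ (-(1 / 2 : ℝ)) := by
              gcongr
          _ = (C₁ + C₂) * ((n : ℝ) ^ (-(1 / 2 - ε)) * Real.log n) := by
              rw [show -(1 / 2 - ε) = ε + -(1 / 2 : ℝ) by ring, Real.rpow_add hn0]
              ring
      · have h0 := diff_prime_eq_zero hb₁ hO₁ hexp₁ hb₂ hO₂ hexp₂ hagree hn hnE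
        rw [h0, norm_zero, zero_mul, zero_mul]
        exact mul_nonneg (by positivity) (Set.indicator_nonneg (fun m hm ↦ mul_nonneg
          (Real.rpow_nonneg (Nat.cast_nonneg m) _)
          (Real.log_nonneg (by exact_mod_cast hm.2.one_lt.le))) n)
    · rw [Set.indicator_of_notMem (show n ∉ {p : ℕ | p.Prime} from hn)]
      exact mul_nonneg (by positivity) (Set.indicator_nonneg (fun m hm ↦ mul_nonneg
        (Real.rpow_nonneg (Nat.cast_nonneg m) _)
        (Real.log_nonneg (by exact_mod_cast hm.2.one_lt.le))) n)

/-- `|c(p^k)| ≤ |b_F(p^k)| + |b_G(p^k)| ≤ 2B p^{kε}` for `k ≤ K` (from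
`SelbergDatum.exists_norm_euler_prime_pow_le` for both data). [cite: Soundararajan2002, p. 1] -/
theorem exists_norm_diff_prime_pow_le
    (hb₁ : ∀ n, ¬ IsPrimePow n → b₁ n = 0) (hO₁ : b₁ =O[atTop] fun n ↦ (n : ℝ) ^ θ₁)
    (hexp₁ : ∀ s : ℂ, 1 < s.re → cexp (LSeries b₁ s) = D₁.toFun s)
    (hb₂ : ∀ n, ¬ IsPrimePow n → b₂ n = 0) (hO₂ : b₂ =O[atTop] fun n ↦ (n : ℝ) ^ θ₂)
    (hexp₂ : ∀ s : ℂ, 1 < s.re → cexp (LSeries b₂ s) = D₂.toFun s)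
    {ε : ℝ} (hε : 0 < ε) (K : ℕ) :
    ∃ B : ℝ, 0 < B ∧ ∀ p : ℕ, p.Prime → ∀ k ≤ K,
      ‖b₁ (p ^ k) - b₂ (p ^ k)‖ ≤ B * (p : ℝ) ^ ((k : ℝ) * ε) := by
  obtain ⟨B₁, hB₁, h₁⟩ := D₁.exists_norm_euler_prime_pow_le hb₁ hO₁ hexp₁ hε K
  obtain ⟨B₂, hB₂, h₂⟩ := D₂.exists_norm_euler_prime_pow_le hb₂ hO₂ hexp₂ hε K
  refine ⟨B₁ + B₂, by positivity, fun p hp k hk ↦ (norm_sub_le _ _).trans ?_⟩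
  rw [add_mul]
  exact add_le_add (h₁ p hp k hk) (h₂ p hp k hk)

/-- `|c(n)| ≤ C n^{θ'}` at every `n ≥ 1`, `θ' = max(θ_F, θ_G, 0) < 1/2` (axiom (v) for both data).
[cite: Soundararajan2002, p. 1] -/
theorem exists_norm_diff_le
    (hO₁ : b₁ =O[atTop] fun n ↦ (n : ℝ) ^ θ₁) (hO₂ : b₂ =O[atTop] fun n ↦ (n : ℝ) ^ θ₂) :
    ∃ C : ℝ, 0 < C ∧ ∀ n : ℕ, 1 ≤ n →
      ‖b₁ n - b₂ n‖ ≤ C * (n : ℝ) ^ (max (max θ₁ θ₂) 0) := by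
  obtain ⟨C₁, hC₁, h₁⟩ := SelbergDatum.exists_norm_euler_le hO₁
  obtain ⟨C₂, hC₂, h₂⟩ := SelbergDatum.exists_norm_euler_le hO₂
  refine ⟨C₁ + C₂, by positivity, fun n hn ↦ (norm_sub_le _ _).trans ?_⟩
  have hn1 : (1 : ℝ) ≤ n := by exact_mod_cast hn
  rw [add_mul]
  refine add_le_add ((h₁ n hn).trans ?_) ((h₂ n hn).trans ?_)
  · exact mul_le_mul_of_nonneg_left (Real.rpow_le_rpow_of_exponent_le hn1
      (max_le_max (le_max_left _ _) le_rfl)) hC₁.le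
  · exact mul_le_mul_of_nonneg_left (Real.rpow_le_rpow_of_exponent_le hn1
      (max_le_max (le_max_right _ _) le_rfl)) hC₂.le

/-- **The prime-square part converges to the right of the critical line**: for `σ > 1/2`,
`∑_p |c(p²)| log(p²) p^{-2σ} < ∞` (Ramanujan: `c(p²) ≪ p^{2ε}`; "entire in `re s > 1/2`", p. 1).
[cite: Soundararajan2002, p. 1] -/
theorem summable_norm_diff_prime_sq
    (hb₁ : ∀ n, ¬ IsPrimePow n → b₁ n = 0) (hO₁ : b₁ =O[atTop] fun n ↦ (n : ℝ) ^ θ₁)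
    (hexp₁ : ∀ s : ℂ, 1 < s.re → cexp (LSeries b₁ s) = D₁.toFun s)
    (hb₂ : ∀ n, ¬ IsPrimePow n → b₂ n = 0) (hO₂ : b₂ =O[atTop] fun n ↦ (n : ℝ) ^ θ₂)
    (hexp₂ : ∀ s : ℂ, 1 < s.re → cexp (LSeries b₂ s) = D₂.toFun s)
    {σ : ℝ} (hσ : 1 / 2 < σ) :
    Summable fun p : Nat.Primes ↦
      ‖b₁ ((p : ℕ) ^ 2) - b₂ ((p : ℕ) ^ 2)‖ * Real.log ((p : ℕ) ^ 2 : ℕ) * (p : ℝ) ^ (-(2 * σ)) := by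
  -- `t = 2σ - 1 > 0`; exponents `ε = t/8`, `η = t/4`
  set t : ℝ := 2 * σ - 1 with ht
  have ht0 : 0 < t := by rw [ht]; linarith
  obtain ⟨B, hB, hBb⟩ := exists_norm_diff_prime_pow_le hb₁ hO₁ hexp₁ hb₂ hO₂ hexp₂
    (ε := t / 8) (by positivity) 2
  -- comparison series `∑_p p^{-(1 + t/2)}`
  have hcomp : Summable fun p : Nat.Primes ↦ (p : ℝ) ^ (-(1 + t / 2)) :=
    Nat.Primes.summable_rpow.mpr (by linarith)
  refine (hcomp.mul_left (B * (2 * (t / 4)⁻¹))).of_nonneg_of_le (fun p ↦ ?_) (fun p ↦ ?_)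
  · exact mul_nonneg (mul_nonneg (norm_nonneg _) (Real.log_natCast_nonneg _))
      (Real.rpow_nonneg (Nat.cast_nonneg _) _)
  · have hp : (p : ℕ).Prime := p.prop
    have hp0 : (0 : ℝ) < (p : ℕ) := by exact_mod_cast hp.pos
    have hc : ‖b₁ ((p : ℕ) ^ 2) - b₂ ((p : ℕ) ^ 2)‖ ≤ B * ((p : ℕ) : ℝ) ^ ((2 : ℝ) * (t / 8)) := by
      simpa using hBb p hp 2 le_rfl
    have hlog : Real.log ((p : ℕ) ^ 2 : ℕ) ≤ 2 * (((p : ℕ) : ℝ) ^ (t / 4) / (t / 4)) := by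
      rw [Nat.cast_pow, Real.log_pow]
      push_cast
      exact mul_le_mul_of_nonneg_left (Real.log_le_rpow_div hp0.le (by positivity)) zero_le_two
    calc ‖b₁ ((p : ℕ) ^ 2) - b₂ ((p : ℕ) ^ 2)‖ * Real.log ((p : ℕ) ^ 2 : ℕ) *
          ((p : ℕ) : ℝ) ^ (-(2 * σ))
        ≤ B * ((p : ℕ) : ℝ) ^ ((2 : ℝ) * (t / 8)) * (2 * (((p : ℕ) : ℝ) ^ (t / 4) / (t / 4))) *
            ((p : ℕ) : ℝ) ^ (-(2 * σ)) := by
          gcongr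
      _ = B * (2 * (t / 4)⁻¹) * ((p : ℕ) : ℝ) ^ (-(1 + t / 2)) := by
          rw [show -(1 + t / 2) = (2 : ℝ) * (t / 8) + t / 4 + -(2 * σ) by rw [ht]; ring,
            Real.rpow_add hp0, Real.rpow_add hp0]
          ring

end Pair


/-! ### Sums over higher prime powers -/

/-- A weighted geometric double series over primes: if `0 ≤ y_p ≤ ρ < 1` and `∑_p w_p y_p^m < ∞`
(`w_p ≥ 0`), then `∑_p ∑_k w_p (k + m) y_p^{k+m} < ∞` (the inner sums are `≤ y_p^m ∑_k (k+m) ρ^k`).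
[folklore] -/
theorem summable_prod_mul_geometric {w y : Nat.Primes → ℝ} {ρ : ℝ} (m : ℕ)
    (hw : ∀ p, 0 ≤ w p) (hy0 : ∀ p, 0 ≤ y p) (hyρ : ∀ p, y p ≤ ρ) (hρ : ρ < 1)
    (hsum : Summable fun p ↦ w p * y p ^ m) :
    Summable fun pk : Nat.Primes × ℕ ↦ w pk.1 * ((pk.2 : ℝ) + m) * y pk.1 ^ (pk.2 + m) := by
  have hρ0 : 0 ≤ ρ := (hy0 ⟨2, Nat.prime_two⟩).trans (hyρ _)
  have hρn : ‖ρ‖ < 1 := by rwa [Real.norm_of_nonneg hρ0]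
  -- the model series `∑_k (k + m) ρ^k`
  have hmodel : Summable fun k : ℕ ↦ ((k : ℝ) + m) * ρ ^ k := by
    have h1 : Summable fun k : ℕ ↦ (k : ℝ) ^ 1 * ρ ^ k := summable_pow_mul_geometric_of_norm_lt_one 1 hρn
    have h2 : Summable fun k : ℕ ↦ (m : ℝ) * ρ ^ k := (summable_geometric_of_lt_one hρ0 hρ).mul_left _
    simpa [pow_one, add_mul] using h1.add h2
  set S : ℝ := ∑' k : ℕ, ((k : ℝ) + m) * ρ ^ k with hS
  have hyk : ∀ p (k : ℕ), ((k : ℝ) + m) * y p ^ k ≤ ((k : ℝ) + m) * ρ ^ k := fun p k ↦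
    mul_le_mul_of_nonneg_left (pow_le_pow_left₀ (hy0 p) (hyρ p) k) (by positivity)
  have hinner : ∀ p, Summable fun k : ℕ ↦ ((k : ℝ) + m) * y p ^ k := fun p ↦
    hmodel.of_nonneg_of_le (fun k ↦ by have := hy0 p; positivity) (hyk p)
  refine (summable_prod_of_nonneg fun pk ↦ ?_).2 ⟨fun p ↦ ?_, ?_⟩
  · have := hw pk.1; have := hy0 pk.1; positivity
  · -- fixed `p`: `w y^m` times the inner series
    have := ((hinner p).mul_left (w p * y p ^ m))
    refine this.congr fun k ↦ ?_
    simp only [pow_add]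
    ring
  · -- the sum over `p` of the inner sums
    have heq : ∀ p, ∑' k : ℕ, w p * ((k : ℝ) + m) * y p ^ (k + m) =
        w p * y p ^ m * ∑' k : ℕ, ((k : ℝ) + m) * y p ^ k := by
      intro p
      rw [← tsum_mul_left]
      refine tsum_congr fun k ↦ ?_
      simp only [pow_add]
      ring
    simp_rw [heq]
    refine (hsum.mul_right S).of_nonneg_of_le (fun p ↦ ?_) (fun p ↦ ?_)
    · have := hw p; have := hy0 p
      exact mul_nonneg (by positivity) (tsum_nonneg fun k ↦ by positivity)
    · have hle : ∑' k : ℕ, ((k : ℝ) + m) * y p ^ k ≤ S :=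
        (hinner p).tsum_le_tsum (hyk p) hmodel
      have := hw p; have := hy0 p
      calc w p * y p ^ m * ∑' k : ℕ, ((k : ℝ) + m) * y p ^ k ≤ w p * y p ^ m * S :=
            mul_le_mul_of_nonneg_left hle (by positivity)
        _ = w p * y p ^ m * S := rfl

/-- `∑_p log p · p^{-a} < ∞` for `a > 1` (primes; absorb the logarithm). [folklore] -/
theorem summable_primes_log_mul_rpow_neg {a : ℝ} (ha : 1 < a) :
    Summable fun p : Nat.Primes ↦ Real.log p * (p : ℝ) ^ (-a) := by
  set η : ℝ := (a - 1) / 2 with hη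
  have hη0 : 0 < η := by rw [hη]; linarith
  have hcomp : Summable fun p : Nat.Primes ↦ (p : ℝ) ^ (-(a - η)) :=
    Nat.Primes.summable_rpow.mpr (by rw [hη]; linarith)
  refine (hcomp.mul_left η⁻¹).of_nonneg_of_le (fun p ↦ ?_) (fun p ↦ ?_)
  · exact mul_nonneg (Real.log_nonneg (by exact_mod_cast p.prop.one_lt.le))
      (Real.rpow_nonneg (Nat.cast_nonneg _) _)
  · have hp0 : (0 : ℝ) < p := by exact_mod_cast p.prop.pos
    calc Real.log p * (p : ℝ) ^ (-a) ≤ ((p : ℝ) ^ η / η) * (p : ℝ) ^ (-a) :=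
          mul_le_mul_of_nonneg_right (Real.log_le_rpow_div hp0.le hη0) (Real.rpow_nonneg hp0.le _)
      _ = η⁻¹ * (p : ℝ) ^ (-(a - η)) := by
          rw [show -(a - η) = η + -a by ring, Real.rpow_add hp0]
          ring

section Pair

variable {D₁ D₂ : SelbergDatum} {b₁ b₂ : ℕ → ℂ} {θ₁ θ₂ : ℝ}

/-- **The higher prime powers converge on the critical line**: `∑_p ∑_{k ≥ 3} |c(p^k)| log(p^k) p^{-k/2}
< ∞` ("since `c(n) ≪ n^ϑ` for `ϑ < 1/2` … `∑_{k ≥ 3} ∑_p |c(p^k) log p g(k log p/L)|/p^{k/2} = O(1)`",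
pp. 1–2). As printed the tail is split at `k = 4` using `ϑ`; in general one splits at `K` with
`K(1/2 − ϑ) > 1` and bounds the finitely many `3 ≤ k < K` by `c(p^k) ≪_k p^{kε}` with `ε = 1/12`.
[cite: Soundararajan2002, pp. 1–2] -/
theorem summable_norm_diff_prime_pow_three
    (hb₁ : ∀ n, ¬ IsPrimePow n → b₁ n = 0) (hO₁ : b₁ =O[atTop] fun n ↦ (n : ℝ) ^ θ₁)
    (hexp₁ : ∀ s : ℂ, 1 < s.re → cexp (LSeries b₁ s) = D₁.toFun s)
    (hb₂ : ∀ n, ¬ IsPrimePow n → b₂ n = 0) (hO₂ : b₂ =O[atTop] fun n ↦ (n : ℝ) ^ θ₂)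
    (hexp₂ : ∀ s : ℂ, 1 < s.re → cexp (LSeries b₂ s) = D₂.toFun s)
    (hθ₁ : θ₁ < 1 / 2) (hθ₂ : θ₂ < 1 / 2) :
    Summable fun pk : Nat.Primes × ℕ ↦
      ‖b₁ ((pk.1 : ℕ) ^ (pk.2 + 3)) - b₂ ((pk.1 : ℕ) ^ (pk.2 + 3))‖ *
        Real.log (((pk.1 : ℕ) ^ (pk.2 + 3) : ℕ)) * ((pk.1 : ℕ) : ℝ) ^ (-(((pk.2 + 3 : ℕ) : ℝ) / 2)) := by
  -- parameters
  set θ' : ℝ := max (max θ₁ θ₂) 0 with hθ'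
  have hθ'0 : 0 ≤ θ' := le_max_right _ _
  have hθ'lt : θ' < 1 / 2 := max_lt (max_lt hθ₁ hθ₂) (by norm_num)
  obtain ⟨C', hC', hC'b⟩ := exists_norm_diff_le hO₁ hO₂ (b₁ := b₁) (b₂ := b₂)
  set K : ℕ := ⌈2 / (1 / 2 - θ')⌉₊ + 3 with hK
  have hK3 : 3 ≤ K := by rw [hK]; omega
  have hKθ : (K : ℝ) * (θ' - 1 / 2) ≤ -2 := by
    have h1 : 2 / (1 / 2 - θ') ≤ (⌈2 / (1 / 2 - θ')⌉₊ : ℝ) := Nat.le_ceil _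
    have h2 : (K : ℝ) = (⌈2 / (1 / 2 - θ')⌉₊ : ℝ) + 3 := by rw [hK]; push_cast; ring
    have hpos : 0 < 1 / 2 - θ' := by linarith
    rw [h2]
    have : 2 ≤ (⌈2 / (1 / 2 - θ')⌉₊ : ℝ) * (1 / 2 - θ') := by
      calc (2 : ℝ) = 2 / (1 / 2 - θ') * (1 / 2 - θ') := by
            rw [div_mul_cancel₀ _ hpos.ne']
        _ ≤ _ := mul_le_mul_of_nonneg_right h1 hpos.le
    nlinarith
  set ε : ℝ := 1 / 12 with hε
  obtain ⟨B, hB, hBb⟩ := exists_norm_diff_prime_pow_le hb₁ hO₁ hexp₁ hb₂ hO₂ hexp₂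
    (ε := ε) (by norm_num) K
  -- the two majorants
  set y₁ : Nat.Primes → ℝ := fun p ↦ ((p : ℕ) : ℝ) ^ (ε - 1 / 2) with hy₁
  set y₂ : Nat.Primes → ℝ := fun p ↦ ((p : ℕ) : ℝ) ^ (θ' - 1 / 2) with hy₂
  have hp0 : ∀ p : Nat.Primes, (0 : ℝ) < ((p : ℕ) : ℝ) := fun p ↦ by exact_mod_cast p.prop.pos
  have hp2 : ∀ p : Nat.Primes, (2 : ℝ) ≤ ((p : ℕ) : ℝ) := fun p ↦ by exact_mod_cast p.prop.two_le
  have hlogp : ∀ p : Nat.Primes, 0 ≤ Real.log ((p : ℕ) : ℝ) := fun p ↦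
    Real.log_nonneg (by linarith [hp2 p])
  have hG₁ : Summable fun pk : Nat.Primes × ℕ ↦
      B * Real.log ((pk.1 : ℕ) : ℝ) * ((pk.2 : ℝ) + (3 : ℕ)) * y₁ pk.1 ^ (pk.2 + 3) := by
    refine summable_prod_mul_geometric 3 (w := fun p ↦ B * Real.log ((p : ℕ) : ℝ))
      (ρ := (2 : ℝ) ^ (ε - 1 / 2)) (fun p ↦ mul_nonneg hB.le (hlogp p))
      (fun p ↦ Real.rpow_nonneg (hp0 p).le _)
      (fun p ↦ Real.rpow_le_rpow_of_nonpos two_pos (hp2 p) (by norm_num))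
      (Real.rpow_lt_one_of_one_lt_of_neg one_lt_two (by norm_num)) ?_
    have h := (summable_primes_log_mul_rpow_neg (a := 3 * (1 / 2 - ε)) (by norm_num)).mul_left B
    refine h.congr fun p ↦ ?_
    simp only [hy₁]
    rw [← Real.rpow_natCast, ← Real.rpow_mul (hp0 p).le]
    push_cast
    ring_nf
  have hG₂ : Summable fun pk : Nat.Primes × ℕ ↦
      C' * Real.log ((pk.1 : ℕ) : ℝ) * ((pk.2 : ℝ) + K) * y₂ pk.1 ^ (pk.2 + K) := by
    refine summable_prod_mul_geometric K (w := fun p ↦ C' * Real.log ((p : ℕ) : ℝ))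
      (ρ := (2 : ℝ) ^ (θ' - 1 / 2)) (fun p ↦ mul_nonneg hC'.le (hlogp p))
      (fun p ↦ Real.rpow_nonneg (hp0 p).le _)
      (fun p ↦ Real.rpow_le_rpow_of_nonpos two_pos (hp2 p) (by linarith))
      (Real.rpow_lt_one_of_one_lt_of_neg one_lt_two (by linarith)) ?_
    have h := (summable_primes_log_mul_rpow_neg (a := -((K : ℝ) * (θ' - 1 / 2))) (by linarith)).mul_left C'
    refine h.congr fun p ↦ ?_
    simp only [hy₂]
    rw [← Real.rpow_natCast, ← Real.rpow_mul (hp0 p).le, neg_neg, mul_comm (θ' - 1 / 2)]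
    ring
  -- the second majorant is used only for `k + 3 ≥ K`: transport along `(p, j) ↦ (p, j + (K - 3))`
  set H : Nat.Primes × ℕ → ℝ := fun pk ↦ if K ≤ pk.2 + 3 then
      C' * Real.log ((pk.1 : ℕ) : ℝ) * ((pk.2 : ℝ) + 3) * y₂ pk.1 ^ (pk.2 + 3) else 0 with hH
  have hHs : Summable H := by
    set e : Nat.Primes × ℕ → Nat.Primes × ℕ := fun pj ↦ (pj.1, pj.2 + (K - 3)) with he
    have hinj : Function.Injective e := by
      intro a b hab
      simp only [he, Prod.mk.injEq] at hab
      exact Prod.ext hab.1 (by omega)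
    have hrange : ∀ x ∉ Set.range e, H x = 0 := by
      intro x hx
      simp only [hH]
      split_ifs with hxK
      · exact absurd ⟨(x.1, x.2 - (K - 3)), by simp only [he]; ext <;> simp; omega⟩ hx
      · rfl
    refine (hinj.summable_iff hrange).mp (hG₂.congr fun pj ↦ ?_)
    simp only [hH, he, Function.comp_apply]
    rw [if_pos (by omega)]
    have : pj.2 + (K - 3) + 3 = pj.2 + K := by omega
    rw [this]
    push_cast [Nat.cast_sub hK3]
    ring
  -- comparison
  refine (hG₁.add hHs).of_nonneg_of_le (fun pk ↦ ?_) (fun pk ↦ ?_)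
  · exact mul_nonneg (mul_nonneg (norm_nonneg _) (Real.log_natCast_nonneg _))
      (Real.rpow_nonneg (Nat.cast_nonneg _) _)
  · obtain ⟨p, k⟩ := pk
    have hpk0 := hp0 p
    have hpp : (p : ℕ).Prime := p.prop
    -- rewrite the summand with `y`'s
    have hlogpow : Real.log (((p : ℕ) ^ (k + 3) : ℕ)) = ((k : ℝ) + (3 : ℕ)) * Real.log ((p : ℕ) : ℝ) := by
      rw [Nat.cast_pow, Real.log_pow]; push_cast; ring
    have hrpow : ∀ u : ℝ, ((p : ℕ) : ℝ) ^ (((k + 3 : ℕ) : ℝ) * u) * ((p : ℕ) : ℝ) ^ (-(((k + 3 : ℕ) : ℝ) / 2)) =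
        (((p : ℕ) : ℝ) ^ (u - 1 / 2)) ^ (k + 3) := by
      intro u
      rw [← Real.rpow_add hpk0, ← Real.rpow_mul_natCast hpk0.le]
      congr 1
      push_cast
      ring
    have hG₁nn : 0 ≤ B * Real.log ((p : ℕ) : ℝ) * ((k : ℝ) + (3 : ℕ)) * y₁ p ^ (k + 3) := by
      have := hlogp p; have : 0 ≤ y₁ p := Real.rpow_nonneg hpk0.le _; positivity
    have hHnn : 0 ≤ H (p, k) := by
      simp only [hH]
      split_ifs
      · have := hlogp p; have : 0 ≤ y₂ p := Real.rpow_nonneg hpk0.le _; positivity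
      · exact le_rfl
    simp only
    rw [hlogpow]
    by_cases hk : k + 3 < K
    · -- small `k`: the `ε`-bound
      have hc : ‖b₁ ((p : ℕ) ^ (k + 3)) - b₂ ((p : ℕ) ^ (k + 3))‖ ≤
          B * ((p : ℕ) : ℝ) ^ (((k + 3 : ℕ) : ℝ) * ε) := hBb p hpp (k + 3) hk.le
      calc ‖b₁ ((p : ℕ) ^ (k + 3)) - b₂ ((p : ℕ) ^ (k + 3))‖ * (((k : ℝ) + (3 : ℕ)) * Real.log ((p : ℕ) : ℝ)) *
            ((p : ℕ) : ℝ) ^ (-(((k + 3 : ℕ) : ℝ) / 2))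
          ≤ B * ((p : ℕ) : ℝ) ^ (((k + 3 : ℕ) : ℝ) * ε) * (((k : ℝ) + (3 : ℕ)) * Real.log ((p : ℕ) : ℝ)) *
            ((p : ℕ) : ℝ) ^ (-(((k + 3 : ℕ) : ℝ) / 2)) := by
              have := hlogp p
              gcongr
        _ = B * Real.log ((p : ℕ) : ℝ) * ((k : ℝ) + (3 : ℕ)) * y₁ p ^ (k + 3) := by
              rw [hy₁]; simp only; rw [← hrpow ε]; ring
        _ ≤ _ := le_add_of_nonneg_right hHnn
    · -- large `k`: the `θ'`-bound
      push Not at hk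
      have hc : ‖b₁ ((p : ℕ) ^ (k + 3)) - b₂ ((p : ℕ) ^ (k + 3))‖ ≤
          C' * ((p : ℕ) : ℝ) ^ (((k + 3 : ℕ) : ℝ) * θ') := by
        have := hC'b ((p : ℕ) ^ (k + 3)) (Nat.one_le_pow _ _ hpp.pos)
        rwa [Nat.cast_pow, ← Real.rpow_natCast, ← Real.rpow_mul hpk0.le] at this
      have hHval : H (p, k) = C' * Real.log ((p : ℕ) : ℝ) * ((k : ℝ) + 3) * y₂ p ^ (k + 3) := by
        simp only [hH]; rw [if_pos hk]
      calc ‖b₁ ((p : ℕ) ^ (k + 3)) - b₂ ((p : ℕ) ^ (k + 3))‖ * (((k : ℝ) + (3 : ℕ)) * Real.log ((p : ℕ) : ℝ)) *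
            ((p : ℕ) : ℝ) ^ (-(((k + 3 : ℕ) : ℝ) / 2))
          ≤ C' * ((p : ℕ) : ℝ) ^ (((k + 3 : ℕ) : ℝ) * θ') * (((k : ℝ) + (3 : ℕ)) * Real.log ((p : ℕ) : ℝ)) *
            ((p : ℕ) : ℝ) ^ (-(((k + 3 : ℕ) : ℝ) / 2)) := by
              have := hlogp p
              gcongr
        _ = H (p, k) := by
              rw [hHval, hy₂]; simp only; rw [← hrpow θ']; push_cast; ring
        _ ≤ _ := le_add_of_nonneg_left hG₁nn

end Pair


/-! ### Assembling the prime-power pieces -/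

/-- A non-negative function supported on the prime powers is summable over `ℕ` as soon as it is
summable along `(p, k) ↦ p^{k+1}` (Mathlib's `Nat.Primes.prodNatEquiv`). [folklore] -/
theorem summable_of_summable_prime_pow {g : ℕ → ℝ} (hg0 : ∀ n, ¬ IsPrimePow n → g n = 0)
    (h : Summable fun pk : Nat.Primes × ℕ ↦ g ((pk.1 : ℕ) ^ (pk.2 + 1))) : Summable g := by
  set i : Nat.Primes × ℕ → ℕ := fun pk ↦ (pk.1 : ℕ) ^ (pk.2 + 1) with hi
  have hinj : Function.Injective i := by
    have : i = Subtype.val ∘ Nat.Primes.prodNatEquiv := by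
      funext pk
      obtain ⟨p, k⟩ := pk
      simp [hi]
    rw [this]
    exact Subtype.val_injective.comp Nat.Primes.prodNatEquiv.injective
  have hrange : ∀ x ∉ Set.range i, g x = 0 := by
    intro x hx
    refine hg0 x fun hxp ↦ hx ?_
    refine ⟨Nat.Primes.prodNatEquiv.symm ⟨x, hxp⟩, ?_⟩
    have := congrArg Subtype.val (Nat.Primes.prodNatEquiv.apply_symm_apply ⟨x, hxp⟩)
    simpa [hi] using this
  exact (hinj.summable_iff hrange).mp h

/-- Summability over `Nat.Primes × ℕ` from the pieces `k = 0`, `k = 1` and `k ≥ 2`. [folklore] -/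
theorem summable_prod_of_parts {G : Nat.Primes × ℕ → ℝ} (hG : ∀ pk, 0 ≤ G pk)
    (h0 : Summable fun p : Nat.Primes ↦ G (p, 0)) (h1 : Summable fun p : Nat.Primes ↦ G (p, 1))
    (h2 : Summable fun pk : Nat.Primes × ℕ ↦ G (pk.1, pk.2 + 2)) : Summable G := by
  have h2' := (summable_prod_of_nonneg (f := fun pk : Nat.Primes × ℕ ↦ G (pk.1, pk.2 + 2))
    fun pk ↦ hG _).1 h2
  refine (summable_prod_of_nonneg hG).2 ⟨fun p ↦ ?_, ?_⟩
  · exact (summable_nat_add_iff (f := fun k ↦ G (p, k)) 2).mp (h2'.1 p)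
  · have heq : ∀ p : Nat.Primes, ∑' k, G (p, k) = G (p, 0) + G (p, 1) + ∑' k, G (p, k + 2) := by
      intro p
      have hs : Summable fun k ↦ G (p, k) :=
        (summable_nat_add_iff (f := fun k ↦ G (p, k)) 2).mp (h2'.1 p)
      rw [← hs.sum_add_tsum_nat_add 2]
      simp [Finset.sum_range_succ]
    simp_rw [heq]
    exact (h0.add h1).add h2'.2

section Pair

variable {D₁ D₂ : SelbergDatum} {b₁ b₂ : ℕ → ℂ} {θ₁ θ₂ : ℝ}

/-- **`∑ |c(n)| Λ(n)-type sums converge to the right of the critical line**: for every `σ > 1/2`,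
`∑_n |c(n)| log n · n^{-σ} < ∞`, `c = b_F − b_G` ("the RHS of (4) is … entire in `re s > 1/2`",
p. 1): primes from the thin set (2), prime squares from Ramanujan, higher powers from `ϑ < 1/2`.
[cite: Soundararajan2002, p. 1] -/
theorem summable_norm_diff_mul_log_mul_rpow
    (hb₁ : ∀ n, ¬ IsPrimePow n → b₁ n = 0) (hO₁ : b₁ =O[atTop] fun n ↦ (n : ℝ) ^ θ₁)
    (hexp₁ : ∀ s : ℂ, 1 < s.re → cexp (LSeries b₁ s) = D₁.toFun s)
    (hb₂ : ∀ n, ¬ IsPrimePow n → b₂ n = 0) (hO₂ : b₂ =O[atTop] fun n ↦ (n : ℝ) ^ θ₂)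
    (hexp₂ : ∀ s : ℂ, 1 < s.re → cexp (LSeries b₂ s) = D₂.toFun s)
    (hθ₁ : θ₁ < 1 / 2) (hθ₂ : θ₂ < 1 / 2)
    {𝓔 : Set ℕ} {δ₀ C : ℝ} (hδ : 0 < δ₀)
    (hthin : ∀ x : ℝ, 2 ≤ x →
      (Set.ncard {p : ℕ | p ∈ 𝓔 ∧ p.Prime ∧ (p : ℝ) ≤ x} : ℝ) ≤ C * x ^ (1 / 2 - δ₀))
    (hagree : ∀ p : ℕ, p.Prime → p ∉ 𝓔 → D₁.coeff p = D₂.coeff p)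
    {σ : ℝ} (hσ : 1 / 2 < σ) :
    Summable fun n : ℕ ↦ ‖b₁ n - b₂ n‖ * Real.log n * (n : ℝ) ^ (-σ) := by
  have hT1 := summable_norm_diff_prime hb₁ hO₁ hexp₁ hb₂ hO₂ hexp₂ hδ hthin hagree
  have hT2 := summable_norm_diff_prime_sq hb₁ hO₁ hexp₁ hb₂ hO₂ hexp₂ hσ
  have hT3 := summable_norm_diff_prime_pow_three hb₁ hO₁ hexp₁ hb₂ hO₂ hexp₂ hθ₁ hθ₂
  set g : ℕ → ℝ := fun n ↦ ‖b₁ n - b₂ n‖ * Real.log n * (n : ℝ) ^ (-σ) with hg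
  have hgnn : ∀ n, 0 ≤ g n := fun n ↦
    mul_nonneg (mul_nonneg (norm_nonneg _) (Real.log_natCast_nonneg n))
      (Real.rpow_nonneg (Nat.cast_nonneg n) _)
  have hg0 : ∀ n, ¬ IsPrimePow n → g n = 0 := fun n hn ↦ by
    simp [hg, hb₁ n hn, hb₂ n hn]
  refine summable_of_summable_prime_pow hg0 (summable_prod_of_parts (fun pk ↦ hgnn _) ?_ ?_ ?_)
  · -- primes: compare with the `σ = 1/2` series `hT1`
    have hT1' : Summable fun p : Nat.Primes ↦
        ‖b₁ p - b₂ p‖ * Real.log p * ((p : ℕ) : ℝ) ^ (-(1 / 2 : ℝ)) :=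
      (summable_subtype_iff_indicator.mpr hT1)
    refine hT1'.of_nonneg_of_le (fun p ↦ hgnn _) (fun p ↦ ?_)
    simp only [hg, zero_add, pow_one]
    refine mul_le_mul_of_nonneg_left ?_ (mul_nonneg (norm_nonneg _) (Real.log_natCast_nonneg _))
    exact Real.rpow_le_rpow_of_exponent_le (by exact_mod_cast p.prop.one_lt.le) (by linarith)
  · -- prime squares: this is `hT2`
    refine hT2.congr fun p ↦ ?_
    have hp0 : (0 : ℝ) ≤ ((p : ℕ) : ℝ) := Nat.cast_nonneg _
    simp only [hg]
    rw [Nat.cast_pow, ← Real.rpow_natCast, ← Real.rpow_mul hp0]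
    norm_num
  · -- higher powers: compare with `hT3`
    refine hT3.of_nonneg_of_le (fun pk ↦ hgnn _) (fun pk ↦ ?_)
    obtain ⟨p, k⟩ := pk
    have hp1 : (1 : ℝ) ≤ ((p : ℕ) : ℝ) := by exact_mod_cast p.prop.one_lt.le
    simp only [hg, show k + 2 + 1 = k + 3 by ring]
    refine mul_le_mul_of_nonneg_left ?_ (mul_nonneg (norm_nonneg _) (Real.log_natCast_nonneg _))
    rw [Nat.cast_pow, ← Real.rpow_natCast, ← Real.rpow_mul (by linarith)]
    exact Real.rpow_le_rpow_of_exponent_le hp1 (by push_cast; nlinarith)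

/-- The same in `LSeries` language: `∑ c(n) log n · n^{-s}` is (absolutely) summable for
`re s > 1/2`. [cite: Soundararajan2002, p. 1] -/
theorem LSeriesSummable_logMul_diff
    (hb₁ : ∀ n, ¬ IsPrimePow n → b₁ n = 0) (hO₁ : b₁ =O[atTop] fun n ↦ (n : ℝ) ^ θ₁)
    (hexp₁ : ∀ s : ℂ, 1 < s.re → cexp (LSeries b₁ s) = D₁.toFun s)
    (hb₂ : ∀ n, ¬ IsPrimePow n → b₂ n = 0) (hO₂ : b₂ =O[atTop] fun n ↦ (n : ℝ) ^ θ₂)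
    (hexp₂ : ∀ s : ℂ, 1 < s.re → cexp (LSeries b₂ s) = D₂.toFun s)
    (hθ₁ : θ₁ < 1 / 2) (hθ₂ : θ₂ < 1 / 2)
    {𝓔 : Set ℕ} {δ₀ C : ℝ} (hδ : 0 < δ₀)
    (hthin : ∀ x : ℝ, 2 ≤ x →
      (Set.ncard {p : ℕ | p ∈ 𝓔 ∧ p.Prime ∧ (p : ℝ) ≤ x} : ℝ) ≤ C * x ^ (1 / 2 - δ₀))
    (hagree : ∀ p : ℕ, p.Prime → p ∉ 𝓔 → D₁.coeff p = D₂.coeff p)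
    {s : ℂ} (hs : 1 / 2 < s.re) :
    LSeriesSummable (LSeries.logMul (b₁ - b₂)) s := by
  have h := summable_norm_diff_mul_log_mul_rpow hb₁ hO₁ hexp₁ hb₂ hO₂ hexp₂ hθ₁ hθ₂ hδ hthin hagree hs
  refine Summable.of_norm (h.congr fun n ↦ ?_)
  rcases Nat.eq_zero_or_pos n with rfl | hn
  · simp [LSeries.term_zero]
  · rw [LSeries.norm_term_eq, if_neg hn.ne', LSeries.logMul, norm_mul, ← Complex.natCast_log,
      Complex.norm_real, Real.norm_of_nonneg (Real.log_natCast_nonneg n), Pi.sub_apply,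
      Real.rpow_neg (Nat.cast_nonneg n), div_eq_mul_inv]
    ring

end Pair

end Soundararajan2004
end Literature.NumberTheory.LFunctions

end
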